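import Summits.CriticalPhenomena.PercolationContinuityZ3.Theorems.PercNearOneGluingNoHeavyLowerTailSahiChainLemma

/-!
# `NoHeavyLowerTail` (crux stmt-CriticalPhenomena-4575), P2 — the chain lemma ON A BOX `2^D ⊆ 2^ι` (relative complement `D ∖ u`)

Memo SAHI-ROUTE.md §4.31 / `G3-REDUCTIONS-PROOFS.md` §6 (seat `prim-masterthm-p2`, gen 9; `--supports stmt-CriticalPhenomena-4575`).
No `sorry`, standard axioms.

This is the version of `…SahiChainLemma` (which treats up-sets of the full cube `Finset (Fin k)`) needed by the orbit
reduction of `G3`: the orbits of the coordinate-swap group on pairs `(x, y)` of the cube are the BOXES `{e ∪ u : u ⊆ D}`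
(`D = x ∆ y`, `e = x ∩ y`), so the antipodal lemma must be available on `D.powerset` with the relative complement `u ↦ D ∖ u`,
for an arbitrary finite index type `ι`.  Statements and proofs are those of `…SahiChainLemma` with `univ` replaced by `D` and
`uᶜ` by `D ∖ u`; the generic lemmas (`det_updateCol_finsetSum`, `natCast_two_pow_zmod_two`, `abel_sum_nonneg`) are imported.
Main results: `SahiBox.exists_chain` (the `GF(2)`/SDR chain on a box) and `SahiBox.exists_chain_matching` (the matching lemma
`M′` in sequence form on a box).
-/

noncomputable section

open scoped Classical

namespace Summit.CriticalPhenomena.PercolationContinuityZ3.Theorems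

namespace SahiBox

open Finset Matrix

variable {ι : Type} [DecidableEq ι]

/-- `D ∖ ((D ∖ a) ∪ b) = a ∖ b` for `a ⊆ D`. [folklore] -/
theorem sdiff_sdiff_union {D a b : Finset ι} (ha : a ⊆ D) : D \ ((D \ a) ∪ b) = a \ b := by
  ext x
  simp only [Finset.mem_sdiff, Finset.mem_union, not_or, not_and, not_not]
  constructor
  · rintro ⟨hxD, h1, h2⟩
    exact ⟨h1 hxD, h2⟩
  · rintro ⟨hxa, hxb⟩
    exact ⟨ha hxa, fun _ => hxa, hxb⟩

/-- The supersets of `a ⊆ D` inside the box `2^D` are `2^{|D ∖ a|}` in number. [folklore] -/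
theorem card_filter_superset_powerset {D a : Finset ι} (ha : a ⊆ D) :
    (D.powerset.filter fun u : Finset ι => a ⊆ u).card = 2 ^ (D \ a).card := by
  have hset : (D.powerset.filter fun u : Finset ι => a ⊆ u) = ((D \ a).powerset).image fun v => a ∪ v := by
    ext u
    simp only [Finset.mem_filter, Finset.mem_powerset, Finset.mem_image]
    constructor
    · rintro ⟨huD, hau⟩
      exact ⟨u \ a, Finset.sdiff_subset_sdiff huD le_rfl, Finset.union_sdiff_of_subset hau⟩
    · rintro ⟨v, hv, rfl⟩
      exact ⟨Finset.union_subset ha (hv.trans Finset.sdiff_subset), Finset.subset_union_left⟩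
  rw [hset, Finset.card_image_of_injOn, Finset.card_powerset]
  intro v hv v' hv' h
  have hv : v ⊆ D \ a := Finset.mem_powerset.1 hv
  have hv' : v' ⊆ D \ a := Finset.mem_powerset.1 hv'
  have hd : Disjoint a v := Finset.disjoint_left.2 fun x hxa hxv => (Finset.mem_sdiff.1 (hv hxv)).2 hxa
  have hd' : Disjoint a v' := Finset.disjoint_left.2 fun x hxa hxv => (Finset.mem_sdiff.1 (hv' hxv)).2 hxa
  have h' : a ∪ v = a ∪ v' := by simpa using h
  calc v = (a ∪ v) \ a := (Finset.union_sdiff_cancel_left hd).symm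
    _ = (a ∪ v') \ a := by rw [h']
    _ = v' := Finset.union_sdiff_cancel_left hd'

/-! ## The containment matrix over `ZMod 2` (box version) -/

/- Throughout, the containment ("zeta") matrix `Z_t(q) = (1[c s ⊆ q j])_{s,j<t}` over `ZMod 2` is written out as
`Matrix.of fun (s j : Fin t) => if c s ⊆ q j then 1 else 0`, and the column vector `w_u = (1[c s ⊆ u])_{s<t}` as
`fun s : Fin t => if c s ⊆ u then 1 else 0` (no auxiliary definitions). -/

/-- `Z_t(q)` only depends on `q 0, …, q (t-1)`. [this work] -/
theorem zetaMat_congr {c q q' : ℕ → Finset ι} {t : ℕ} (h : ∀ j < t, q j = q' j) :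
    (Matrix.of fun (s : Fin (t)) (j : Fin (t)) => if c (s : ℕ) ⊆ (q) (j : ℕ) then (1 : ZMod 2) else 0) = (Matrix.of fun (s : Fin (t)) (j : Fin (t)) => if c (s : ℕ) ⊆ (q') (j : ℕ) then (1 : ZMod 2) else 0) := by
  ext s j
  simp only [Matrix.of_apply, h j j.isLt]

/-- Replacing `q t` by `u` replaces the last column of `Z_{t+1}` by `w_u`. [this work] -/
theorem zetaMat_update (c q : ℕ → Finset ι) (t : ℕ) (u : Finset ι) :
    (Matrix.of fun (s : Fin (t + 1)) (j : Fin (t + 1)) => if c (s : ℕ) ⊆ (Function.update q t u) (j : ℕ) then (1 : ZMod 2) else 0) = ((Matrix.of fun (s : Fin (t + 1)) (j : Fin (t + 1)) => if c (s : ℕ) ⊆ (q) (j : ℕ) then (1 : ZMod 2) else 0)).updateCol (Fin.last t) (fun s : Fin (t + 1) => if c (s : ℕ) ⊆ u then (1 : ZMod 2) else 0) := by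
  ext s j
  by_cases hj : j = Fin.last t
  · subst hj
    simp only [Matrix.of_apply, Matrix.updateCol_self, Fin.val_last, Function.update_self]
  · have hjt : (j : ℕ) ≠ t := fun h => hj (Fin.ext (by rw [h, Fin.val_last]))
    simp only [Matrix.of_apply, Matrix.updateCol_ne hj, Function.update_of_ne hjt]

/-- The upper-left block of `Z_{t+1}(q)` with the last column replaced is `Z_t(q)`. [this work] -/
theorem zetaMat_submatrix_castSucc (c q : ℕ → Finset ι) (t : ℕ) (v : Fin (t + 1) → ZMod 2) :
    (((Matrix.of fun (s : Fin (t + 1)) (j : Fin (t + 1)) => if c (s : ℕ) ⊆ (q) (j : ℕ) then (1 : ZMod 2) else 0)).updateCol (Fin.last t) v).submatrix Fin.castSucc Fin.castSucc = (Matrix.of fun (s : Fin (t)) (j : Fin (t)) => if c (s : ℕ) ⊆ (q) (j : ℕ) then (1 : ZMod 2) else 0) := by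
  ext s j
  rw [Matrix.submatrix_apply, Matrix.updateCol_ne (Fin.castSucc_lt_last j).ne, Matrix.of_apply, Matrix.of_apply,
    Fin.val_castSucc, Fin.val_castSucc]

/-! ## The one-step lemma -/

section chain

/- Standing hypotheses (passed explicitly): `hup` — `U` is an up-set; `hmem` — `c 0, …, c (m-1) ∈ U`;
`hlin` — `c` is a linear extension (hence injective) on `[0, m)`: `c t ⊆ c s → t ≤ s`. -/
variable {D : Finset ι} {U : Finset (Finset ι)} {c : ℕ → Finset ι} {m : ℕ}

/-- The column sum `Σ_{u ∈ U, (D \ c t) ⊆ u} w_u` is the last basis vector: its `s`-th entry counts the supersets of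
`(D \ c t) ∪ c s`, all of which lie in the up-set `U ∋ c s`; there are `2^{|c t ∖ c s|}` of them, odd iff `c t ⊆ c s` iff `s = t`. [this work] -/
theorem sum_wvec_eq_single (hUD : ∀ x ∈ U, x ⊆ D) (hup : ∀ ⦃x y : Finset ι⦄, x ∈ U → x ⊆ y → y ⊆ D → y ∈ U)
    (hmem : ∀ s < m, c s ∈ U) (hlin : ∀ s t, s < m → t < m → c t ⊆ c s → t ≤ s) {t : ℕ} (ht : t < m) :
    ∑ u ∈ U.filter (fun u => (D \ c t) ⊆ u), (fun s : Fin (t + 1) => if c (s : ℕ) ⊆ u then (1 : ZMod 2) else 0) = Pi.single (Fin.last t) 1 := by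
  ext s
  have hs : (s : ℕ) < m := lt_of_le_of_lt (Nat.lt_succ_iff.1 s.isLt) ht
  rw [Finset.sum_apply, Finset.sum_boole, Finset.filter_filter]
  -- the double filter is the set of all supersets of `a := (D \ c t) ∪ c s`
  have hfilt : (U.filter fun u => (D \ c t) ⊆ u ∧ c ↑s ⊆ u) =
      D.powerset.filter fun u : Finset ι => (D \ c t) ∪ c s ⊆ u := by
    ext u
    simp only [Finset.mem_filter, Finset.mem_powerset, Finset.union_subset_iff]
    constructor
    · exact fun hu => ⟨hUD u hu.1, hu.2⟩
    · exact fun hu => ⟨hup (hmem s hs) hu.2.2 hu.1, hu.2⟩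
  have haD : (D \ c t) ∪ c ↑s ⊆ D := Finset.union_subset Finset.sdiff_subset (hUD _ (hmem s hs))
  rw [hfilt, card_filter_superset_powerset haD, SahiSharedCube.natCast_two_pow_zmod_two]
  have hcompl : (D \ ((D \ c t) ∪ c ↑s)).card = 0 ↔ c t ⊆ c s := by
    rw [Finset.card_eq_zero, sdiff_sdiff_union (hUD _ (hmem t ht)), Finset.sdiff_eq_empty_iff_subset]
  by_cases hst : s = Fin.last t
  · subst hst
    have : c t ⊆ c ↑(Fin.last t) := by rw [Fin.val_last]
    rw [if_pos (hcompl.2 this), Pi.single_eq_same]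
  · have hlt : (s : ℕ) < t := by
      rcases lt_or_eq_of_le (Nat.lt_succ_iff.1 s.isLt) with h1 | h1
      · exact h1
      · exact absurd (Fin.ext (by rw [h1, Fin.val_last])) hst
    have hns : ¬ c t ⊆ c ↑s := fun hsub => absurd (hlin s t hs ht hsub) (not_le.2 hlt)
    rw [if_neg (mt hcompl.1 hns), Pi.single_eq_of_ne hst]

/-- **One-step lemma (determinant form).**  `Σ_{u ∈ U, (D \ c t) ⊆ u} det Z_{t+1}(q[t ↦ u]) = det Z_t(q)` in `ZMod 2`. [this work] -/
theorem sum_det_zetaMat_update (hUD : ∀ x ∈ U, x ⊆ D) (hup : ∀ ⦃x y : Finset ι⦄, x ∈ U → x ⊆ y → y ⊆ D → y ∈ U)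
    (hmem : ∀ s < m, c s ∈ U) (hlin : ∀ s t, s < m → t < m → c t ⊆ c s → t ≤ s) (q : ℕ → Finset ι) {t : ℕ} (ht : t < m) :
    ∑ u ∈ U.filter (fun u => (D \ c t) ⊆ u), ((Matrix.of fun (s : Fin (t + 1)) (j : Fin (t + 1)) => if c (s : ℕ) ⊆ (Function.update q t u) (j : ℕ) then (1 : ZMod 2) else 0)).det = ((Matrix.of fun (s : Fin (t)) (j : Fin (t)) => if c (s : ℕ) ⊆ (q) (j : ℕ) then (1 : ZMod 2) else 0)).det := by
  simp_rw [zetaMat_update]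
  rw [SahiSharedCube.det_updateCol_finsetSum, sum_wvec_eq_single hUD hup hmem hlin ht, Matrix.det_succ_column _ (Fin.last t),
    Finset.sum_eq_single (Fin.last t)]
  · have h1 : (-1 : ZMod 2) ^ ((Fin.last t : ℕ) + (Fin.last t : ℕ)) = 1 := by
      have : (-1 : ZMod 2) = 1 := by decide
      rw [this, one_pow]
    rw [h1, one_mul, Matrix.updateCol_self, Pi.single_eq_same, one_mul, Fin.succAbove_last,
      zetaMat_submatrix_castSucc]
  · intro i _ hi
    rw [Matrix.updateCol_self, Pi.single_eq_of_ne hi, mul_zero, zero_mul]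
  · intro hn
    exact absurd (Finset.mem_univ _) hn

/-- **One-step lemma (existence form).**  If `det Z_t(q) = 1` then some `u ∈ U` with `(D \ c t) ⊆ u` keeps
`det Z_{t+1}(q[t ↦ u]) = 1` (the number of such `u` is odd). [this work] -/
theorem exists_good_cover (hUD : ∀ x ∈ U, x ⊆ D) (hup : ∀ ⦃x y : Finset ι⦄, x ∈ U → x ⊆ y → y ⊆ D → y ∈ U)
    (hmem : ∀ s < m, c s ∈ U) (hlin : ∀ s t, s < m → t < m → c t ⊆ c s → t ≤ s) (q : ℕ → Finset ι) {t : ℕ} (ht : t < m)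
    (hdet : ((Matrix.of fun (s : Fin (t)) (j : Fin (t)) => if c (s : ℕ) ⊆ (q) (j : ℕ) then (1 : ZMod 2) else 0)).det = 1) :
    ∃ u ∈ U, (D \ c t) ⊆ u ∧ ((Matrix.of fun (s : Fin (t + 1)) (j : Fin (t + 1)) => if c (s : ℕ) ⊆ (Function.update q t u) (j : ℕ) then (1 : ZMod 2) else 0)).det = 1 := by
  have hsum := sum_det_zetaMat_update hUD hup hmem hlin q ht
  rw [hdet] at hsum
  have hne : ∑ u ∈ U.filter (fun u => (D \ c t) ⊆ u), ((Matrix.of fun (s : Fin (t + 1)) (j : Fin (t + 1)) => if c (s : ℕ) ⊆ (Function.update q t u) (j : ℕ) then (1 : ZMod 2) else 0)).det ≠ 0 := by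
    rw [hsum]; exact one_ne_zero
  obtain ⟨u, hu, hu'⟩ := Finset.exists_ne_zero_of_sum_ne_zero hne
  rw [Finset.mem_filter] at hu
  have h01 : ∀ x : ZMod 2, x ≠ 0 → x = 1 := by decide
  exact ⟨u, hu.1, hu.2, h01 _ hu'⟩

/-! ## The chain -/

/-- **`GF(2)`-chain.**  There is `p` with `p t ∈ U`, `(D \ c t) ⊆ p t` (`t < m`) and `det Z_t(p) = 1` for every `t ≤ m`. [this work] -/
theorem exists_gf2_chain (hUD : ∀ x ∈ U, x ⊆ D) (hup : ∀ ⦃x y : Finset ι⦄, x ∈ U → x ⊆ y → y ⊆ D → y ∈ U)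
    (hmem : ∀ s < m, c s ∈ U) (hlin : ∀ s t, s < m → t < m → c t ⊆ c s → t ≤ s) :
    ∃ p : ℕ → Finset ι, (∀ t < m, p t ∈ U ∧ (D \ c t) ⊆ p t) ∧ ∀ t ≤ m, ((Matrix.of fun (s : Fin (t)) (j : Fin (t)) => if c (s : ℕ) ⊆ (p) (j : ℕ) then (1 : ZMod 2) else 0)).det = 1 := by
  suffices hmain : ∀ n ≤ m, ∃ p : ℕ → Finset ι,
      (∀ t < n, p t ∈ U ∧ (D \ c t) ⊆ p t) ∧ ∀ t ≤ n, ((Matrix.of fun (s : Fin (t)) (j : Fin (t)) => if c (s : ℕ) ⊆ (p) (j : ℕ) then (1 : ZMod 2) else 0)).det = 1 from hmain m le_rfl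
  intro n
  induction n with
  | zero =>
    intro _
    refine ⟨fun _ => ∅, fun t ht => absurd ht (Nat.not_lt_zero t), fun t ht => ?_⟩
    obtain rfl := Nat.le_zero.1 ht
    exact Matrix.det_isEmpty
  | succ n ih =>
    intro hn
    obtain ⟨p, hp1, hp2⟩ := ih (Nat.le_of_succ_le hn)
    have hnm : n < m := Nat.lt_of_succ_le hn
    obtain ⟨u, huU, huc, hdet⟩ := exists_good_cover hUD hup hmem hlin p hnm (hp2 n le_rfl)
    refine ⟨Function.update p n u, fun t ht => ?_, fun t ht => ?_⟩
    · rcases Nat.lt_succ_iff_lt_or_eq.1 ht with hlt | rfl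
      · rw [Function.update_of_ne (Nat.ne_of_lt hlt)]
        exact hp1 t hlt
      · rw [Function.update_self]
        exact ⟨huU, huc⟩
    · rcases Nat.lt_or_eq_of_le ht with hlt | rfl
      · have hle : t ≤ n := Nat.lt_succ_iff.1 hlt
        rw [zetaMat_congr (q := Function.update p n u) (q' := p) fun j hj =>
          Function.update_of_ne (Nat.ne_of_lt (lt_of_lt_of_le hj hle)) u p]
        exact hp2 t hle
      · exact hdet

/-- `det Z_t(q) ≠ 0` exhibits a permutation `σ` of the prefix with `c (σ j) ⊆ q j` for all `j < t`. [this work] -/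
theorem exists_dominating_perm (c q : ℕ → Finset ι) (t : ℕ) (hdet : ((Matrix.of fun (s : Fin (t)) (j : Fin (t)) => if c (s : ℕ) ⊆ (q) (j : ℕ) then (1 : ZMod 2) else 0)).det ≠ 0) :
    ∃ σ : Equiv.Perm (Fin t), ∀ j : Fin t, c (σ j) ⊆ q j := by
  rw [Matrix.det_apply] at hdet
  obtain ⟨σ, -, hσ⟩ := Finset.exists_ne_zero_of_sum_ne_zero hdet
  refine ⟨σ, fun j => ?_⟩
  by_contra hc
  apply hσ
  have hzero : ∏ i, ((Matrix.of fun (s : Fin (t)) (j : Fin (t)) => if c (s : ℕ) ⊆ (q) (j : ℕ) then (1 : ZMod 2) else 0)) (σ i) i = 0 :=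
    Finset.prod_eq_zero (Finset.mem_univ j) (by simp [hc])
  rw [hzero, smul_zero]

/-- Two equal values `q i = q j` (`i ≠ j < t`) make `det Z_t(q) = 0`. [this work] -/
theorem det_zetaMat_eq_zero_of_eq (c q : ℕ → Finset ι) (t : ℕ) {i j : Fin t} (hij : i ≠ j)
    (hq : q i = q j) : ((Matrix.of fun (s : Fin (t)) (j : Fin (t)) => if c (s : ℕ) ⊆ (q) (j : ℕ) then (1 : ZMod 2) else 0)).det = 0 :=
  Matrix.det_zero_of_column_eq hij fun s => by simp [hq]

/-- **The chain (sequence form of `(SDR-chain)`).**  For an up-set `U` of the box `2^D` enumerated along a linear extension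
`c 0, …, c (m-1)` there are `p 0, …, p (m-1) ∈ U`, pairwise distinct, with `(D \ c t) ⊆ p t`, such that every prefix
`c 0..c (t-1)` is matched into `p 0..p (t-1)` by a permutation `σ` with `c (σ j) ⊆ p j`. [this work] -/
theorem exists_chain (hUD : ∀ x ∈ U, x ⊆ D) (hup : ∀ ⦃x y : Finset ι⦄, x ∈ U → x ⊆ y → y ⊆ D → y ∈ U)
    (hmem : ∀ s < m, c s ∈ U) (hlin : ∀ s t, s < m → t < m → c t ⊆ c s → t ≤ s) :
    ∃ p : ℕ → Finset ι, (∀ t < m, p t ∈ U) ∧ (∀ t < m, (D \ c t) ⊆ p t) ∧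
      (∀ s t, s < m → t < m → p s = p t → s = t) ∧
      ∀ t ≤ m, ∃ σ : Equiv.Perm (Fin t), ∀ j : Fin t, c (σ j) ⊆ p j := by
  obtain ⟨p, hp1, hp2⟩ := exists_gf2_chain hUD hup hmem hlin
  refine ⟨p, fun t ht => (hp1 t ht).1, fun t ht => (hp1 t ht).2, fun s t hs ht hst => ?_, fun t ht => ?_⟩
  · by_contra hne
    have h0 := det_zetaMat_eq_zero_of_eq c p m (i := ⟨s, hs⟩) (j := ⟨t, ht⟩)
      (fun heq => hne (by simpa using congrArg Fin.val heq)) hst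
    rw [hp2 m le_rfl] at h0
    exact one_ne_zero h0
  · exact exists_dominating_perm c p t (by rw [hp2 t ht]; exact one_ne_zero)

end chain

/-! ## Abel summation: the matching inequality of `M′` in sequence form -/

omit [DecidableEq ι] in
/-- A dominating permutation of the prefix gives `Σ_{j<t} H (c j) ≤ Σ_{j<t} H (p j)` for monotone `H`. [this work] -/
theorem prefix_sum_le_of_perm {c p : ℕ → Finset ι} {t : ℕ} (σ : Equiv.Perm (Fin t))
    (hσ : ∀ j : Fin t, c (σ j) ⊆ p j) (H : Finset ι → ℝ) (hH : Monotone H) :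
    ∑ j ∈ Finset.range t, H (c j) ≤ ∑ j ∈ Finset.range t, H (p j) := by
  rw [← Fin.sum_univ_eq_sum_range (fun j => H (c j)) t, ← Fin.sum_univ_eq_sum_range (fun j => H (p j)) t]
  calc ∑ i : Fin t, H (c i) = ∑ i : Fin t, H (c (σ i)) := (Equiv.sum_comp σ (fun i : Fin t => H (c i))).symm
    _ ≤ ∑ i : Fin t, H (p i) := Finset.sum_le_sum fun i _ => hH (hσ i)

omit [DecidableEq ι] in
/-- **`M′` in sequence form.**  If every prefix of `c` is dominated by the corresponding prefix of `p`, then for `H` monotone and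
weights `a t = F (D \ c t)` antitone and nonnegative in `t`:  `Σ_{t<m} a t · H (c t) ≤ Σ_{t<m} a t · H (p t)`. [this work] -/
theorem chain_sum_le {c p : ℕ → Finset ι} {m : ℕ}
    (hdom : ∀ t ≤ m, ∃ σ : Equiv.Perm (Fin t), ∀ j : Fin t, c (σ j) ⊆ p j)
    (H : Finset ι → ℝ) (hH : Monotone H) (a : ℕ → ℝ)
    (ha : ∀ s t, s ≤ t → t < m → a t ≤ a s) (ha0 : ∀ t < m, 0 ≤ a t) :
    ∑ t ∈ Finset.range m, a t * H (c t) ≤ ∑ t ∈ Finset.range m, a t * H (p t) := by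
  have key := SahiSharedCube.abel_sum_nonneg m a (fun t => H (p t) - H (c t)) ha ha0 (fun t ht => by
    obtain ⟨σ, hσ⟩ := hdom t ht
    have := prefix_sum_le_of_perm σ hσ H hH
    rw [Finset.sum_sub_distrib]
    linarith)
  have : ∑ t ∈ Finset.range m, a t * (H (p t) - H (c t)) =
      ∑ t ∈ Finset.range m, a t * H (p t) - ∑ t ∈ Finset.range m, a t * H (c t) := by
    rw [← Finset.sum_sub_distrib]
    exact Finset.sum_congr rfl fun t _ => by ring
  linarith

/-- **The matching lemma `M′` (sequence form, §4.30/§6 of the memo).**  For an up-set `U` of the box `2^D` enumerated along a linear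
extension `c`, there is a rearrangement `p` of covers — `p t ∈ U` pairwise distinct, `(D \ c t) ⊆ p t` — such that
`Σ_{t<m} a t · H (c t) ≤ Σ_{t<m} a t · H (p t)` for EVERY monotone `H` and EVERY antitone nonnegative weight `a`
(take `a t = F (D \ c t)` for `F ≥ 0` increasing and `c` chosen with `t ↦ F (D \ c t)` non-increasing). [this work] -/
theorem exists_chain_matching {D : Finset ι} {U : Finset (Finset ι)} {c : ℕ → Finset ι} {m : ℕ}
    (hUD : ∀ x ∈ U, x ⊆ D) (hup : ∀ ⦃x y : Finset ι⦄, x ∈ U → x ⊆ y → y ⊆ D → y ∈ U)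
    (hmem : ∀ s < m, c s ∈ U) (hlin : ∀ s t, s < m → t < m → c t ⊆ c s → t ≤ s) :
    ∃ p : ℕ → Finset ι, (∀ t < m, p t ∈ U) ∧ (∀ t < m, (D \ c t) ⊆ p t) ∧
      (∀ s t, s < m → t < m → p s = p t → s = t) ∧
      ∀ (H : Finset ι → ℝ), Monotone H → ∀ (a : ℕ → ℝ), (∀ s t, s ≤ t → t < m → a t ≤ a s) →
        (∀ t < m, 0 ≤ a t) → ∑ t ∈ Finset.range m, a t * H (c t) ≤ ∑ t ∈ Finset.range m, a t * H (p t) := by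
  obtain ⟨p, hp1, hp2, hp3, hp4⟩ := exists_chain hUD hup hmem hlin
  exact ⟨p, hp1, hp2, hp3, fun H hH a ha ha0 => chain_sum_le hp4 H hH a ha ha0⟩


end SahiBox

end Summit.CriticalPhenomena.PercolationContinuityZ3.Theorems
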